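import Literature.Analysis.InverseSpectral.StieltjesSupport
import HarnessLib

/-!
# The Stieltjes representation of Kreĭn's class `(S)`

A function `f` holomorphic on `ℂ ∖ [0, ∞)` with `Im f ≥ 0` on the upper half-plane, real and
non-negative on `(-∞, 0)` and conjugation-symmetric is of the form

  `f(z) = b + ∫_{[0,∞)} dσ(t)/(t - z)`,  `b ≥ 0`, `∫ dσ(t)/(1 + t) < ∞`

(`isNevanlinnaStieltjes_of_nevanlinna_representation`; Kac–Kreĭn 1974, Supplement I, Theorem
S1.5.1), i.e. `f ∈ N_S` in the notation of `KreinString.lean`. The proof starts from Nevanlinna's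
representation `f = b + cz + π⁻¹ ∫ (1/(t-z) - t/(1+t²)) dμ` on `Π`
(`Literature.Analysis.Complex.nevanlinna_representation`, taken as a hypothesis), shows
`μ((-∞,0)) = 0` (`StieltjesSupport`), extends the formula to the negative axis by dominated
convergence, and reads off from `f(-s) ≥ 0` (`s → ∞`) that `c = 0`, `∫ t dμ/(1+t²) < ∞` and
`b - π⁻¹ ∫ t dμ/(1+t²) ≥ 0`; the lower half-plane is reached by conjugation symmetry.

## References

KacKrein1974 (Supplement I, §S1.5, Theorem S1.5.1), RosenblumRovnyak1985 (Appendix §6).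
-/

open MeasureTheory Filter Set Topology Metric
open scoped ENNReal NNReal ComplexConjugate

noncomputable section

namespace Literature.Analysis.InverseSpectral

/-- `ℂ ∖ [0, ∞)` is open (copy of `isOpen_offNonnegAxis` in `KreinStringWeylAnalytic`, to keep
this file independent of the string files). [folklore] -/
private theorem isOpen_offNonnegAxis' : IsOpen offNonnegAxis :=
  (isOpen_ne_fun Complex.continuous_im continuous_const).union
    (isOpen_lt Complex.continuous_re continuous_const)

/-- `ℂ ∖ [0, ∞)` is stable under conjugation (private copy). [folklore] -/
private theorem conj_mem_offNonnegAxis' {z : ℂ} (hz : z ∈ offNonnegAxis) : conj z ∈ offNonnegAxis := by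
  rcases hz with h | h
  · exact Or.inl (by simpa using h)
  · exact Or.inr (by simpa using h)

/-! ### The kernel at points of the left half-plane -/

/-- On the negative axis the Nevanlinna kernel is real: `1/(t+s) - t/(1+t²)`. [folklore] -/
lemma nevanlinnaKernel_neg_ofReal (s t : ℝ) :
    ((t : ℂ) - (-(s : ℂ)))⁻¹ - (t : ℂ) / (1 + (t : ℂ) ^ 2) =
      (((t + s)⁻¹ - t / (1 + t ^ 2) : ℝ) : ℂ) := by
  push_cast
  ring

/-- Splitting of the real kernel: `1/(t+s) - t/(1+t²) = 1/((t+s)(1+t²)) - ts/((t+s)(1+t²))`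
(`t + s ≠ 0`). [folklore] -/
lemma real_kernel_split {s t : ℝ} (h : t + s ≠ 0) :
    (t + s)⁻¹ - t / (1 + t ^ 2) = ((t + s) * (1 + t ^ 2))⁻¹ - t * s / ((t + s) * (1 + t ^ 2)) := by
  have h2 : (1 : ℝ) + t ^ 2 ≠ 0 := by positivity
  field_simp
  ring

/-- **Kernel bound in the left half-plane**: for `Re z ≤ -s < 0`, `|z| ≤ R` and `t ≥ 0`,
`|1/(t-z) - t/(1+t²)| ≤ (s⁻¹ + R)(1+t²)⁻¹`. [folklore] -/
lemma norm_nevanlinnaKernel_le_of_re_le {z : ℂ} {s R : ℝ} (hs : 0 < s) (hzs : z.re ≤ -s)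
    (hzR : ‖z‖ ≤ R) {t : ℝ} (ht : 0 ≤ t) :
    ‖((t : ℂ) - z)⁻¹ - (t : ℂ) / (1 + (t : ℂ) ^ 2)‖ ≤ (s⁻¹ + R) * (1 + t ^ 2)⁻¹ := by
  have hts : t + s ≤ ‖(t : ℂ) - z‖ := by
    have h := Complex.abs_re_le_norm ((t : ℂ) - z)
    have h2 : ((t : ℂ) - z).re = t - z.re := by simp
    rw [h2] at h
    have : t + s ≤ |t - z.re| := by rw [abs_of_nonneg (by linarith)]; linarith
    exact this.trans h
  have hd0 : 0 < ‖(t : ℂ) - z‖ := lt_of_lt_of_le (by linarith) hts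
  have hne : (t : ℂ) - z ≠ 0 := norm_pos_iff.1 hd0
  have hsq : (1 : ℂ) + (t : ℂ) ^ 2 = ((1 + t ^ 2 : ℝ) : ℂ) := by push_cast; ring
  have hsq0 : (1 : ℂ) + (t : ℂ) ^ 2 ≠ 0 := by
    rw [hsq, Complex.ofReal_ne_zero]
    positivity
  have heq : ((t : ℂ) - z)⁻¹ - (t : ℂ) / (1 + (t : ℂ) ^ 2) =
      (1 + (t : ℂ) * z) / (((t : ℂ) - z) * (1 + (t : ℂ) ^ 2)) := by
    field_simp
    ring
  rw [heq, norm_div, norm_mul, hsq, Complex.norm_real, Real.norm_eq_abs,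
    abs_of_pos (by positivity : (0 : ℝ) < 1 + t ^ 2)]
  have hR : 0 ≤ R := (norm_nonneg _).trans hzR
  have hnum : ‖1 + (t : ℂ) * z‖ ≤ 1 + t * R := by
    calc ‖1 + (t : ℂ) * z‖ ≤ ‖(1 : ℂ)‖ + ‖(t : ℂ) * z‖ := norm_add_le _ _
      _ = 1 + t * ‖z‖ := by
          rw [norm_one, norm_mul, Complex.norm_real, Real.norm_eq_abs, abs_of_nonneg ht]
      _ ≤ 1 + t * R := by gcongr
  rw [div_le_iff₀ (by positivity)]
  calc ‖1 + (t : ℂ) * z‖ ≤ 1 + t * R := hnum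
    _ ≤ (s⁻¹ + R) * (t + s) := by
        rw [add_mul]
        have h1 : 1 ≤ s⁻¹ * (t + s) := by
          rw [inv_mul_eq_div, le_div_iff₀ hs]; linarith
        nlinarith
    _ ≤ (s⁻¹ + R) * ‖(t : ℂ) - z‖ := by gcongr
    _ = (s⁻¹ + R) * (1 + t ^ 2)⁻¹ * (‖(t : ℂ) - z‖ * (1 + t ^ 2)) := by
        field_simp

section Stieltjes

variable {μ : Measure ℝ} {b c : ℝ} {f : ℂ → ℂ}

/-- **The representation on the negative axis.** If `f` is continuous at the points of `(-∞, 0)`,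
is given on `Π` by Nevanlinna's formula and the representing measure lives on `[0, ∞)`, then the
formula also holds at `z = -s`, `s > 0` (dominated convergence along `-s + i/k`).
[cite: KacKrein1974, Supplement I §S1.5] -/
theorem nevanlinna_repr_neg (hμ : Integrable (fun t : ℝ => (1 + t ^ 2)⁻¹) μ) (hμ0 : μ (Iio 0) = 0)
    (hrep : ∀ z : ℂ, 0 < z.im → f z = (b : ℂ) + (c : ℂ) * z +
      (Real.pi : ℂ)⁻¹ * ∫ t : ℝ, (((t : ℂ) - z)⁻¹ - (t : ℂ) / (1 + (t : ℂ) ^ 2)) ∂μ)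
    (hcont : ∀ s : ℝ, 0 < s → ContinuousAt f (-(s : ℂ))) {s : ℝ} (hs : 0 < s) :
    f (-(s : ℂ)) = (b : ℂ) + (c : ℂ) * (-(s : ℂ)) +
      (Real.pi : ℂ)⁻¹ * ∫ t : ℝ, (((t : ℂ) - (-(s : ℂ)))⁻¹ - (t : ℂ) / (1 + (t : ℂ) ^ 2)) ∂μ := by
  have hae : ∀ᵐ t ∂μ, 0 ≤ t := by
    rw [ae_iff]
    have hset : {a : ℝ | ¬0 ≤ a} = Iio 0 := by
      ext a
      simp
    rw [hset]
    exact hμ0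
  -- the approximating points `zₖ = -s + i/(k+1)`
  set yk : ℕ → ℝ := fun k => 1 / ((k : ℝ) + 1) with hyk
  have hyk_pos : ∀ k, 0 < yk k := fun k => by rw [hyk]; positivity
  have hyk_le : ∀ k, yk k ≤ 1 := fun k => by
    rw [hyk]
    simp only
    rw [div_le_one (by positivity)]
    linarith [(Nat.cast_nonneg k : (0 : ℝ) ≤ k)]
  set zk : ℕ → ℂ := fun k => -(s : ℂ) + (yk k : ℂ) * Complex.I with hzk
  have hzk_im : ∀ k, (zk k).im = yk k := fun k => by simp [hzk]
  have hzk_re : ∀ k, (zk k).re = -s := fun k => by simp [hzk]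
  have hzk_pos : ∀ k, 0 < (zk k).im := fun k => by rw [hzk_im]; exact hyk_pos k
  have hzk_norm : ∀ k, ‖zk k‖ ≤ s + 1 := fun k => by
    calc ‖zk k‖ ≤ ‖(-(s : ℂ))‖ + ‖(yk k : ℂ) * Complex.I‖ := norm_add_le _ _
      _ = s + yk k := by
          rw [norm_neg, Complex.norm_real, norm_mul, Complex.norm_I, mul_one, Complex.norm_real,
            Real.norm_eq_abs, Real.norm_eq_abs, abs_of_pos hs, abs_of_pos (hyk_pos k)]
      _ ≤ s + 1 := by linarith [hyk_le k]
  have hzk_lim : Tendsto zk atTop (𝓝 (-(s : ℂ))) := by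
    have h1 : Tendsto yk atTop (𝓝 0) := tendsto_one_div_add_atTop_nhds_zero_nat
    have h2 := ((Complex.continuous_ofReal.tendsto 0).comp h1).mul_const Complex.I
    simp only [Function.comp_def, Complex.ofReal_zero, zero_mul] at h2
    have h3 := (tendsto_const_nhds (x := -(s : ℂ))).add h2
    rw [add_zero] at h3
    exact h3
  -- left-hand sides converge
  have hL : Tendsto (fun k => f (zk k)) atTop (𝓝 (f (-(s : ℂ)))) :=
    (hcont s hs).tendsto.comp hzk_lim
  -- right-hand sides converge (dominated convergence)
  have hR : Tendsto (fun k => (b : ℂ) + (c : ℂ) * zk k + (Real.pi : ℂ)⁻¹ *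
      ∫ t : ℝ, (((t : ℂ) - zk k)⁻¹ - (t : ℂ) / (1 + (t : ℂ) ^ 2)) ∂μ) atTop
      (𝓝 ((b : ℂ) + (c : ℂ) * (-(s : ℂ)) + (Real.pi : ℂ)⁻¹ *
        ∫ t : ℝ, (((t : ℂ) - (-(s : ℂ)))⁻¹ - (t : ℂ) / (1 + (t : ℂ) ^ 2)) ∂μ)) := by
    refine (tendsto_const_nhds.add (hzk_lim.const_mul _)).add (Tendsto.const_mul _ ?_)
    refine tendsto_integral_of_dominated_convergence (fun t => (s⁻¹ + (s + 1)) * (1 + t ^ 2)⁻¹)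
      (fun k => (continuous_nevanlinnaKernel (hzk_pos k).ne').aestronglyMeasurable)
      (hμ.const_mul _) (fun k => ?_) ?_
    · filter_upwards [hae] with t ht
      exact norm_nevanlinnaKernel_le_of_re_le hs (by rw [hzk_re]) (hzk_norm k) ht
    · filter_upwards [hae] with t ht
      have hne : (t : ℂ) - (-(s : ℂ)) ≠ 0 := by
        rw [sub_neg_eq_add, ← Complex.ofReal_add, Complex.ofReal_ne_zero]; linarith
      have hc1 : ContinuousAt (fun z : ℂ => ((t : ℂ) - z)⁻¹ - (t : ℂ) / (1 + (t : ℂ) ^ 2))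
          (-(s : ℂ)) :=
        ((continuousAt_const.sub continuousAt_id).inv₀ hne).sub continuousAt_const
      exact hc1.tendsto.comp hzk_lim
  have heq : ∀ k, f (zk k) = (b : ℂ) + (c : ℂ) * zk k + (Real.pi : ℂ)⁻¹ *
      ∫ t : ℝ, (((t : ℂ) - zk k)⁻¹ - (t : ℂ) / (1 + (t : ℂ) ^ 2)) ∂μ := fun k => hrep _ (hzk_pos k)
  exact tendsto_nhds_unique (hL.congr heq) hR

/-- `∀ᵐ t ∂μ, 0 ≤ t` when `μ((-∞,0)) = 0`. [folklore] -/
lemma ae_nonneg_of_measure_Iio_eq_zero (hμ0 : μ (Iio 0) = 0) : ∀ᵐ t ∂μ, (0 : ℝ) ≤ t := by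
  rw [ae_iff]
  have hset : {a : ℝ | ¬0 ≤ a} = Iio 0 := by
    ext a
    simp
  rw [hset]
  exact hμ0

/-- Integrability of `1/((t+s)(1+t²))` (`s > 0`, `μ` on `[0,∞)` with `∫ dμ/(1+t²) < ∞`), with the
bound `∫ ≤ s⁻¹ ∫ dμ/(1+t²)`. [folklore] -/
lemma integrable_inv_mul_kernel (hμ : Integrable (fun t : ℝ => (1 + t ^ 2)⁻¹) μ)
    (hμ0 : μ (Iio 0) = 0) {s : ℝ} (hs : 0 < s) :
    Integrable (fun t : ℝ => ((t + s) * (1 + t ^ 2))⁻¹) μ ∧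
      ∫ t, ((t + s) * (1 + t ^ 2))⁻¹ ∂μ ≤ s⁻¹ * ∫ t, (1 + t ^ 2)⁻¹ ∂μ := by
  have hae := ae_nonneg_of_measure_Iio_eq_zero hμ0
  have hbd : ∀ᵐ t ∂μ, ‖((t + s) * (1 + t ^ 2))⁻¹‖ ≤ s⁻¹ * (1 + t ^ 2)⁻¹ := by
    filter_upwards [hae] with t ht
    rw [Real.norm_eq_abs, abs_of_nonneg (by positivity), mul_inv]
    exact mul_le_mul_of_nonneg_right (inv_anti₀ hs (by linarith)) (inv_nonneg.2 (by positivity))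
  have hmeas : AEStronglyMeasurable (fun t : ℝ => ((t + s) * (1 + t ^ 2))⁻¹) μ := by
    refine Measurable.aestronglyMeasurable ?_
    fun_prop
  have hint : Integrable (fun t : ℝ => ((t + s) * (1 + t ^ 2))⁻¹) μ :=
    Integrable.mono' (hμ.const_mul _) hmeas hbd
  refine ⟨hint, ?_⟩
  rw [← integral_const_mul]
  refine integral_mono_ae hint (hμ.const_mul _) ?_
  filter_upwards [hbd, hae] with t ht ht0
  rwa [Real.norm_eq_abs, abs_of_nonneg (by positivity)] at ht

/-- Integrability of `ts/((t+s)(1+t²))` (`s > 0`, `μ` on `[0,∞)`), bounded by `s/(1+t²)`.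
[folklore] -/
lemma integrable_mul_kernel (hμ : Integrable (fun t : ℝ => (1 + t ^ 2)⁻¹) μ)
    (hμ0 : μ (Iio 0) = 0) {s : ℝ} (hs : 0 < s) :
    Integrable (fun t : ℝ => t * s / ((t + s) * (1 + t ^ 2))) μ := by
  have hae := ae_nonneg_of_measure_Iio_eq_zero hμ0
  have hbd : ∀ᵐ t ∂μ, ‖t * s / ((t + s) * (1 + t ^ 2))‖ ≤ s * (1 + t ^ 2)⁻¹ := by
    filter_upwards [hae] with t ht
    rw [Real.norm_eq_abs, abs_of_nonneg (by positivity), div_eq_mul_inv, mul_inv]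
    have h1 : t * (t + s)⁻¹ ≤ 1 := by
      rw [← div_eq_mul_inv, div_le_one (by positivity)]; linarith
    have h2 : 0 ≤ (1 + t ^ 2)⁻¹ := inv_nonneg.2 (by positivity)
    calc t * s * ((t + s)⁻¹ * (1 + t ^ 2)⁻¹) = (t * (t + s)⁻¹) * (s * (1 + t ^ 2)⁻¹) := by ring
      _ ≤ 1 * (s * (1 + t ^ 2)⁻¹) := by gcongr
      _ = s * (1 + t ^ 2)⁻¹ := one_mul _
  have hmeas : AEStronglyMeasurable (fun t : ℝ => t * s / ((t + s) * (1 + t ^ 2))) μ := by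
    refine Measurable.aestronglyMeasurable ?_
    fun_prop
  exact Integrable.mono' (hμ.const_mul _) hmeas hbd

/-- **Real part on the negative axis**: with `A(s) = ∫ dμ/((t+s)(1+t²))`,
`B(s) = ∫ ts dμ/((t+s)(1+t²))`, `Re f(-s) = b - c s + π⁻¹ (A(s) - B(s))`.
[cite: KacKrein1974, Supplement I §S1.5] -/
theorem re_apply_neg_eq (hμ : Integrable (fun t : ℝ => (1 + t ^ 2)⁻¹) μ) (hμ0 : μ (Iio 0) = 0)
    (hrep : ∀ z : ℂ, 0 < z.im → f z = (b : ℂ) + (c : ℂ) * z +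
      (Real.pi : ℂ)⁻¹ * ∫ t : ℝ, (((t : ℂ) - z)⁻¹ - (t : ℂ) / (1 + (t : ℂ) ^ 2)) ∂μ)
    (hcont : ∀ s : ℝ, 0 < s → ContinuousAt f (-(s : ℂ))) {s : ℝ} (hs : 0 < s) :
    (f (-(s : ℂ))).re = b - c * s + Real.pi⁻¹ *
      ((∫ t, ((t + s) * (1 + t ^ 2))⁻¹ ∂μ) - ∫ t, t * s / ((t + s) * (1 + t ^ 2)) ∂μ) := by
  have hae := ae_nonneg_of_measure_Iio_eq_zero hμ0
  rw [nevanlinna_repr_neg hμ hμ0 hrep hcont hs]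
  have hK : ∫ t : ℝ, (((t : ℂ) - (-(s : ℂ)))⁻¹ - (t : ℂ) / (1 + (t : ℂ) ^ 2)) ∂μ =
      (((∫ t, ((t + s) * (1 + t ^ 2))⁻¹ ∂μ) -
        ∫ t, t * s / ((t + s) * (1 + t ^ 2)) ∂μ : ℝ) : ℂ) := by
    rw [← integral_sub (integrable_inv_mul_kernel hμ hμ0 hs).1 (integrable_mul_kernel hμ hμ0 hs),
      ← integral_complex_ofReal]
    refine integral_congr_ae ?_
    filter_upwards [hae] with t ht
    rw [nevanlinnaKernel_neg_ofReal, real_kernel_split (by linarith)]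
  rw [hK]
  have hpi : ((Real.pi : ℂ)⁻¹) = ((Real.pi⁻¹ : ℝ) : ℂ) := by push_cast; rfl
  rw [hpi]
  simp only [Complex.add_re, Complex.ofReal_re, Complex.mul_re, Complex.neg_re, Complex.ofReal_im,
    Complex.neg_im, neg_zero, mul_zero, sub_zero]
  ring

/-- **`c = 0` for a function of class `(S)`**: `0 ≤ Re f(-s) = b - cs + π⁻¹(A(s) - B(s))`,
`A(s) ≤ K/s`, `B(s) ≥ 0` force `c ≤ 0`. [cite: KacKrein1974, Supplement I §S1.5] -/
theorem c_eq_zero_of_nonneg (hμ : Integrable (fun t : ℝ => (1 + t ^ 2)⁻¹) μ) (hμ0 : μ (Iio 0) = 0)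
    (hc : 0 ≤ c)
    (hrep : ∀ z : ℂ, 0 < z.im → f z = (b : ℂ) + (c : ℂ) * z +
      (Real.pi : ℂ)⁻¹ * ∫ t : ℝ, (((t : ℂ) - z)⁻¹ - (t : ℂ) / (1 + (t : ℂ) ^ 2)) ∂μ)
    (hcont : ∀ s : ℝ, 0 < s → ContinuousAt f (-(s : ℂ)))
    (hpos : ∀ s : ℝ, 0 < s → 0 ≤ (f (-(s : ℂ))).re) : c = 0 := by
  have hae := ae_nonneg_of_measure_Iio_eq_zero hμ0
  set K := ∫ t, (1 + t ^ 2)⁻¹ ∂μ with hK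
  have hK0 : 0 ≤ K := integral_nonneg (fun t => by positivity)
  -- `c s ≤ b + π⁻¹ K/s` for all `s > 0`
  have hineq : ∀ s : ℝ, 0 < s → c * s ≤ b + Real.pi⁻¹ * (s⁻¹ * K) := by
    intro s hs
    have h0 := hpos s hs
    rw [re_apply_neg_eq hμ hμ0 hrep hcont hs] at h0
    have hA := (integrable_inv_mul_kernel hμ hμ0 hs).2
    have hB : 0 ≤ ∫ t, t * s / ((t + s) * (1 + t ^ 2)) ∂μ :=
      integral_nonneg_of_ae (by filter_upwards [hae] with t ht; positivity)
    have hpi : 0 < Real.pi⁻¹ := inv_pos.2 Real.pi_pos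
    nlinarith [mul_le_mul_of_nonneg_left hA hpi.le, mul_nonneg hpi.le hB]
  by_contra hne
  have hc' : 0 < c := lt_of_le_of_ne hc (Ne.symm hne)
  set s₀ := max 1 ((|b| + Real.pi⁻¹ * K) / c + 1) with hs₀
  have hs₀1 : 1 ≤ s₀ := le_max_left _ _
  have hs₀0 : 0 < s₀ := by linarith
  have h1 := hineq s₀ hs₀0
  have h2 : s₀⁻¹ * K ≤ K := by
    calc s₀⁻¹ * K ≤ 1 * K := by gcongr; exact inv_le_one_of_one_le₀ hs₀1
      _ = K := one_mul K
  have h3 : (|b| + Real.pi⁻¹ * K) / c + 1 ≤ s₀ := le_max_right _ _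
  have h4 : |b| + Real.pi⁻¹ * K + c ≤ c * s₀ := by
    have := mul_le_mul_of_nonneg_left h3 hc'.le
    rwa [mul_add, mul_div_cancel₀ _ hc'.ne', mul_one] at this
  have hpi : 0 ≤ Real.pi⁻¹ := inv_nonneg.2 Real.pi_pos.le
  nlinarith [le_abs_self b, mul_le_mul_of_nonneg_left h2 hpi]

/-- `B(s) ≤ π b + K/s` when `c = 0` and `Re f(-s) ≥ 0`. [cite: KacKrein1974, Supplement I §S1.5] -/
lemma B_le_of_nonneg (hμ : Integrable (fun t : ℝ => (1 + t ^ 2)⁻¹) μ) (hμ0 : μ (Iio 0) = 0)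
    (hrep : ∀ z : ℂ, 0 < z.im → f z = (b : ℂ) + (c : ℂ) * z +
      (Real.pi : ℂ)⁻¹ * ∫ t : ℝ, (((t : ℂ) - z)⁻¹ - (t : ℂ) / (1 + (t : ℂ) ^ 2)) ∂μ)
    (hcont : ∀ s : ℝ, 0 < s → ContinuousAt f (-(s : ℂ)))
    (hpos : ∀ s : ℝ, 0 < s → 0 ≤ (f (-(s : ℂ))).re) (hc0 : c = 0) {s : ℝ} (hs : 0 < s) :
    ∫ t, t * s / ((t + s) * (1 + t ^ 2)) ∂μ ≤
      Real.pi * b + s⁻¹ * ∫ t, (1 + t ^ 2)⁻¹ ∂μ := by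
  have h0 := hpos s hs
  rw [re_apply_neg_eq hμ hμ0 hrep hcont hs, hc0, zero_mul, sub_zero] at h0
  have hA := (integrable_inv_mul_kernel hμ hμ0 hs).2
  have hpi := Real.pi_pos
  -- `0 ≤ b + π⁻¹ (A - B)` gives `B ≤ π b + A`
  have h1 : ∫ t, t * s / ((t + s) * (1 + t ^ 2)) ∂μ ≤
      Real.pi * b + ∫ t, ((t + s) * (1 + t ^ 2))⁻¹ ∂μ := by
    have h2 := mul_nonneg hpi.le h0
    rw [mul_add, ← mul_assoc, mul_inv_cancel₀ hpi.ne', one_mul] at h2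
    linarith
  linarith

/-- **Finiteness of the first moment against `dμ/(1+t²)`**: `∫ t dμ(t)/(1+t²) < ∞`
(monotone convergence in `B(n) ≤ πb + K`). [cite: KacKrein1974, Supplement I §S1.5] -/
theorem integrable_moment_of_nonneg (hμ : Integrable (fun t : ℝ => (1 + t ^ 2)⁻¹) μ)
    (hμ0 : μ (Iio 0) = 0)
    (hrep : ∀ z : ℂ, 0 < z.im → f z = (b : ℂ) + (c : ℂ) * z +
      (Real.pi : ℂ)⁻¹ * ∫ t : ℝ, (((t : ℂ) - z)⁻¹ - (t : ℂ) / (1 + (t : ℂ) ^ 2)) ∂μ)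
    (hcont : ∀ s : ℝ, 0 < s → ContinuousAt f (-(s : ℂ)))
    (hpos : ∀ s : ℝ, 0 < s → 0 ≤ (f (-(s : ℂ))).re) (hc0 : c = 0) :
    Integrable (fun t : ℝ => t / (1 + t ^ 2)) μ := by
  have hae := ae_nonneg_of_measure_Iio_eq_zero hμ0
  set K := ∫ t, (1 + t ^ 2)⁻¹ ∂μ with hK
  have hK0 : 0 ≤ K := integral_nonneg (fun t => by positivity)
  -- the increasing sequence `Fₙ(t) = t(n+1)/((t+n+1)(1+t²)) ↑ t/(1+t²)`
  set F : ℕ → ℝ → ℝ≥0∞ := fun n t =>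
    ENNReal.ofReal (t * ((n : ℝ) + 1) / ((t + ((n : ℝ) + 1)) * (1 + t ^ 2))) with hF
  have hFmeas : ∀ n, AEMeasurable (F n) μ := fun n => by
    refine (ENNReal.measurable_ofReal.comp ?_).aemeasurable
    fun_prop
  have hFmono : ∀ᵐ t ∂μ, Monotone fun n => F n t := by
    filter_upwards [hae] with t ht
    refine monotone_nat_of_le_succ (fun n => ENNReal.ofReal_le_ofReal ?_)
    push_cast
    rw [div_le_div_iff₀ (by positivity) (by positivity)]
    nlinarith [sq_nonneg t, mul_nonneg ht (sq_nonneg t)]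
  have hFlim : ∀ᵐ t ∂μ, ⨆ n, F n t = ENNReal.ofReal (t / (1 + t ^ 2)) := by
    filter_upwards [hae, hFmono] with t ht hmono
    have htend : Tendsto (fun n => F n t) atTop (𝓝 (ENNReal.ofReal (t / (1 + t ^ 2)))) := by
      have h1 : Tendsto (fun n : ℕ => ((n : ℝ) + 1) / (((n : ℝ) + 1) + t)) atTop (𝓝 1) := by
        have h := (tendsto_natCast_div_add_atTop t).comp (tendsto_add_atTop_nat 1)
        refine h.congr (fun n => ?_)
        simp [Function.comp]
      have h2 := (ENNReal.continuous_ofReal.tendsto _).comp ((h1.const_mul (t / (1 + t ^ 2))))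
      rw [mul_one] at h2
      refine h2.congr (fun n => ?_)
      simp only [Function.comp_apply, hF]
      congr 1
      field_simp
      ring
    exact tendsto_nhds_unique (tendsto_atTop_iSup hmono) htend
  -- the integrals of `Fₙ` are `B(n+1) ≤ πb + K`
  have hFint : ∀ n, ∫⁻ t, F n t ∂μ ≤ ENNReal.ofReal (Real.pi * b + K) := by
    intro n
    have hs : (0 : ℝ) < (n : ℝ) + 1 := by positivity
    have hB := B_le_of_nonneg hμ hμ0 hrep hcont hpos hc0 hs
    have hint := integrable_mul_kernel hμ hμ0 hs
    rw [hF, ← ofReal_integral_eq_lintegral_ofReal hint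
      (by filter_upwards [hae] with t ht; positivity)]
    refine ENNReal.ofReal_le_ofReal (hB.trans ?_)
    have : ((n : ℝ) + 1)⁻¹ * K ≤ K := by
      calc ((n : ℝ) + 1)⁻¹ * K ≤ 1 * K := by
            gcongr
            exact inv_le_one_of_one_le₀ (by linarith [(Nat.cast_nonneg n : (0 : ℝ) ≤ n)])
        _ = K := one_mul K
    linarith
  have hlin : ∫⁻ t, ENNReal.ofReal (t / (1 + t ^ 2)) ∂μ ≤ ENNReal.ofReal (Real.pi * b + K) := by
    rw [← lintegral_congr_ae hFlim, lintegral_iSup' hFmeas hFmono]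
    exact iSup_le hFint
  refine ⟨(by fun_prop : Measurable fun t : ℝ => t / (1 + t ^ 2)).aestronglyMeasurable, ?_⟩
  rw [hasFiniteIntegral_iff_enorm]
  calc ∫⁻ t, ‖t / (1 + t ^ 2)‖ₑ ∂μ = ∫⁻ t, ENNReal.ofReal (t / (1 + t ^ 2)) ∂μ := by
        refine lintegral_congr_ae ?_
        filter_upwards [hae] with t ht
        exact Real.enorm_eq_ofReal (by positivity)
    _ ≤ ENNReal.ofReal (Real.pi * b + K) := hlin
    _ < ⊤ := ENNReal.ofReal_lt_top

/-- **The Stieltjes constant is non-negative**: `0 ≤ b - π⁻¹ ∫ t dμ/(1+t²)` (`= lim_{s→∞} f(-s)`).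
[cite: KacKrein1974, Supplement I §S1.5] -/
theorem stieltjes_const_nonneg (hμ : Integrable (fun t : ℝ => (1 + t ^ 2)⁻¹) μ)
    (hμ0 : μ (Iio 0) = 0)
    (hrep : ∀ z : ℂ, 0 < z.im → f z = (b : ℂ) + (c : ℂ) * z +
      (Real.pi : ℂ)⁻¹ * ∫ t : ℝ, (((t : ℂ) - z)⁻¹ - (t : ℂ) / (1 + (t : ℂ) ^ 2)) ∂μ)
    (hcont : ∀ s : ℝ, 0 < s → ContinuousAt f (-(s : ℂ)))
    (hpos : ∀ s : ℝ, 0 < s → 0 ≤ (f (-(s : ℂ))).re) (hc0 : c = 0) :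
    0 ≤ b - Real.pi⁻¹ * ∫ t, t / (1 + t ^ 2) ∂μ := by
  have hae := ae_nonneg_of_measure_Iio_eq_zero hμ0
  have hJ := integrable_moment_of_nonneg hμ hμ0 hrep hcont hpos hc0
  set K := ∫ t, (1 + t ^ 2)⁻¹ ∂μ with hK
  have hK0 : 0 ≤ K := integral_nonneg (fun t => by positivity)
  -- `A(n+1) → 0`
  have hA : Tendsto (fun n : ℕ => ∫ t, ((t + ((n : ℝ) + 1)) * (1 + t ^ 2))⁻¹ ∂μ) atTop (𝓝 0) := by
    have hle : ∀ n : ℕ, ∫ t, ((t + ((n : ℝ) + 1)) * (1 + t ^ 2))⁻¹ ∂μ ≤ ((n : ℝ) + 1)⁻¹ * K :=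
      fun n => (integrable_inv_mul_kernel hμ hμ0 (by positivity : (0 : ℝ) < n + 1)).2
    have hge : ∀ n : ℕ, 0 ≤ ∫ t, ((t + ((n : ℝ) + 1)) * (1 + t ^ 2))⁻¹ ∂μ := fun n =>
      integral_nonneg_of_ae (by filter_upwards [hae] with t ht; positivity)
    have hlim : Tendsto (fun n : ℕ => ((n : ℝ) + 1)⁻¹ * K) atTop (𝓝 (0 * K)) := by
      refine Tendsto.mul_const K ?_
      have h := tendsto_one_div_add_atTop_nhds_zero_nat (𝕜 := ℝ)
      simpa using h
    rw [zero_mul] at hlim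
    exact tendsto_of_tendsto_of_tendsto_of_le_of_le tendsto_const_nhds hlim hge hle
  -- `B(n+1) → J`
  have hB : Tendsto (fun n : ℕ => ∫ t, t * ((n : ℝ) + 1) / ((t + ((n : ℝ) + 1)) * (1 + t ^ 2)) ∂μ)
      atTop (𝓝 (∫ t, t / (1 + t ^ 2) ∂μ)) := by
    refine tendsto_integral_of_dominated_convergence (fun t => t / (1 + t ^ 2))
      (fun n => ((by fun_prop : Measurable fun t : ℝ =>
        t * ((n : ℝ) + 1) / ((t + ((n : ℝ) + 1)) * (1 + t ^ 2))).aestronglyMeasurable))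
      hJ (fun n => ?_) ?_
    · filter_upwards [hae] with t ht
      rw [Real.norm_eq_abs, abs_of_nonneg (by positivity), div_le_div_iff₀ (by positivity)
        (by positivity)]
      nlinarith [sq_nonneg t, mul_nonneg ht (sq_nonneg t)]
    · filter_upwards [hae] with t ht
      have h1 : Tendsto (fun n : ℕ => ((n : ℝ) + 1) / (((n : ℝ) + 1) + t)) atTop (𝓝 1) := by
        have h := (tendsto_natCast_div_add_atTop t).comp (tendsto_add_atTop_nat 1)
        refine h.congr (fun n => ?_)
        simp [Function.comp]
      have h2 := h1.const_mul (t / (1 + t ^ 2))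
      rw [mul_one] at h2
      refine h2.congr (fun n => ?_)
      field_simp
      ring
  -- pass to the limit in `0 ≤ b + π⁻¹ (A(n+1) - B(n+1))`
  have hall : ∀ n : ℕ, 0 ≤ b + Real.pi⁻¹ *
      ((∫ t, ((t + ((n : ℝ) + 1)) * (1 + t ^ 2))⁻¹ ∂μ) -
        ∫ t, t * ((n : ℝ) + 1) / ((t + ((n : ℝ) + 1)) * (1 + t ^ 2)) ∂μ) := by
    intro n
    have h := hpos ((n : ℝ) + 1) (by positivity)
    rw [re_apply_neg_eq hμ hμ0 hrep hcont (by positivity), hc0, zero_mul, sub_zero] at h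
    exact h
  have hlim := (tendsto_const_nhds (x := b)).add ((hA.sub hB).const_mul Real.pi⁻¹)
  have h := ge_of_tendsto' hlim hall
  linarith [h]

/-! ### The representation off `[0, ∞)` -/

/-- Points of `ℂ ∖ [0, ∞)` stay away from `[0, ∞)`. [folklore] -/
lemma exists_pos_le_norm_sub {z : ℂ} (hz : z ∈ offNonnegAxis) :
    ∃ d : ℝ, 0 < d ∧ ∀ t : ℝ, 0 ≤ t → d ≤ ‖(t : ℂ) - z‖ := by
  by_cases him : z.im = 0
  · have hre : z.re < 0 := by
      rcases hz with h | h
      · exact absurd him h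
      · exact h
    refine ⟨-z.re, by linarith, fun t ht => ?_⟩
    have h := Complex.abs_re_le_norm ((t : ℂ) - z)
    have h2 : ((t : ℂ) - z).re = t - z.re := by simp
    rw [h2, abs_of_nonneg (by linarith)] at h
    linarith
  · refine ⟨|z.im|, abs_pos.2 him, fun t _ => ?_⟩
    have h := Complex.abs_im_le_norm ((t : ℂ) - z)
    simpa using h

/-- **Bound for the Cauchy kernel off `[0, ∞)`**: `|t - z|⁻¹ ≤ D_z (1 + t)⁻¹` for `t ≥ 0`.
[folklore] -/
lemma exists_norm_inv_sub_le {z : ℂ} (hz : z ∈ offNonnegAxis) :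
    ∃ D : ℝ, 0 ≤ D ∧ ∀ t : ℝ, 0 ≤ t → ‖((t : ℂ) - z)⁻¹‖ ≤ D * (1 + t)⁻¹ := by
  obtain ⟨d, hd, hdle⟩ := exists_pos_le_norm_sub hz
  set D := max 2 ((2 * ‖z‖ + 2) / d) with hD
  refine ⟨D, by positivity, fun t ht => ?_⟩
  have hd0 : 0 < ‖(t : ℂ) - z‖ := lt_of_lt_of_le hd (hdle t ht)
  -- it suffices to bound `(1 + t) ≤ D |t - z|`
  suffices h : 1 + t ≤ D * ‖(t : ℂ) - z‖ by
    rw [norm_inv, inv_eq_one_div, div_le_iff₀ hd0, mul_assoc, inv_mul_eq_div,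
      mul_div_assoc', one_le_div (by positivity : (0 : ℝ) < 1 + t)]
    exact h
  rcases le_or_gt t (2 * ‖z‖ + 1) with h1 | h1
  · calc 1 + t ≤ 2 * ‖z‖ + 2 := by linarith
      _ = (2 * ‖z‖ + 2) / d * d := by field_simp
      _ ≤ D * ‖(t : ℂ) - z‖ := by
          gcongr
          · exact le_max_right _ _
          · exact hdle t ht
  · have h2 : (1 + t) / 2 ≤ ‖(t : ℂ) - z‖ := by
      have h3 := norm_sub_norm_le (t : ℂ) z
      rw [Complex.norm_real, Real.norm_eq_abs, abs_of_nonneg ht] at h3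
      linarith
    calc 1 + t = 2 * ((1 + t) / 2) := by ring
      _ ≤ D * ‖(t : ℂ) - z‖ := by
          gcongr
          exact le_max_left _ _

/-- `(1+t)⁻¹ ≤ (1+t²)⁻¹ + t (1+t²)⁻¹` for `t ≥ 0`. [folklore] -/
lemma inv_one_add_le {t : ℝ} (ht : 0 ≤ t) : (1 + t)⁻¹ ≤ (1 + t ^ 2)⁻¹ + t / (1 + t ^ 2) := by
  have h : (1 + t ^ 2)⁻¹ + t / (1 + t ^ 2) = (1 + t) / (1 + t ^ 2) := by
    field_simp
  rw [h, inv_eq_one_div, div_le_div_iff₀ (by positivity) (by positivity)]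
  nlinarith

/-- Integrability of the Cauchy kernel `(t - z)⁻¹` for `z ∉ [0, ∞)` against a measure on `[0, ∞)`
with `∫ (1 + t) dμ/(1+t²) < ∞`. [folklore] -/
lemma integrable_inv_sub (hμ : Integrable (fun t : ℝ => (1 + t ^ 2)⁻¹) μ) (hμ0 : μ (Iio 0) = 0)
    (hJ : Integrable (fun t : ℝ => t / (1 + t ^ 2)) μ) {z : ℂ} (hz : z ∈ offNonnegAxis) :
    Integrable (fun t : ℝ => ((t : ℂ) - z)⁻¹) μ := by
  obtain ⟨D, hD0, hD⟩ := exists_norm_inv_sub_le hz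
  refine Integrable.mono' ((hμ.add hJ).const_mul D)
    ((Complex.measurable_ofReal.sub_const z).inv.aestronglyMeasurable) ?_
  filter_upwards [ae_nonneg_of_measure_Iio_eq_zero hμ0] with t ht
  calc ‖((t : ℂ) - z)⁻¹‖ ≤ D * (1 + t)⁻¹ := hD t ht
    _ ≤ D * ((1 + t ^ 2)⁻¹ + t / (1 + t ^ 2)) := by gcongr; exact inv_one_add_le ht

/-- **The formula at one point.** If `f(z) = b + π⁻¹ ∫ (1/(t-z) - t/(1+t²)) dμ` at some
`z ∉ [0, ∞)` and `∫ t dμ/(1+t²) < ∞`, then `f(z) = (b - π⁻¹ ∫ t dμ/(1+t²)) + ∫ dσ(t)/(t - z)` with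
`σ = π⁻¹ μ`. [folklore] -/
lemma apply_eq_const_add_integral (hμ : Integrable (fun t : ℝ => (1 + t ^ 2)⁻¹) μ)
    (hμ0 : μ (Iio 0) = 0) (hJ : Integrable (fun t : ℝ => t / (1 + t ^ 2)) μ) {z : ℂ}
    (hz : z ∈ offNonnegAxis) {w : ℂ}
    (hw : w = (b : ℂ) + (Real.pi : ℂ)⁻¹ *
      ∫ t : ℝ, (((t : ℂ) - z)⁻¹ - (t : ℂ) / (1 + (t : ℂ) ^ 2)) ∂μ) :
    w = ((b - Real.pi⁻¹ * ∫ t, t / (1 + t ^ 2) ∂μ : ℝ) : ℂ) +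
      ∫ t : ℝ, ((t : ℂ) - z)⁻¹ ∂((ENNReal.ofReal Real.pi⁻¹) • μ) := by
  have hint := integrable_inv_sub hμ hμ0 hJ hz
  have hJ' : Integrable (fun t : ℝ => (t : ℂ) / (1 + (t : ℂ) ^ 2)) μ := by
    have h := hJ.ofReal (𝕜 := ℂ)
    refine h.congr (ae_of_all _ fun t => ?_)
    dsimp only
    push_cast
    rfl
  rw [hw, integral_sub hint hJ', integral_smul_measure, ENNReal.toReal_ofReal
    (inv_nonneg.2 Real.pi_pos.le), Complex.real_smul]
  have hJeq : ∫ t : ℝ, (t : ℂ) / (1 + (t : ℂ) ^ 2) ∂μ = ((∫ t, t / (1 + t ^ 2) ∂μ : ℝ) : ℂ) := by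
    rw [← integral_complex_ofReal]
    refine integral_congr_ae (ae_of_all _ fun t => ?_)
    push_cast
    ring
  rw [hJeq]
  push_cast
  ring

/-- **Stieltjes representation of Kreĭn's class `(S)`** (Kac–Kreĭn 1974, Supplement I, Theorem
S1.5.1), from Nevanlinna's representation of the Pick class: a function holomorphic on `ℂ ∖ [0, ∞)`
with `Im f ≥ 0` on the upper half-plane, real and non-negative on `(-∞, 0)` and
conjugation-symmetric is `b + ∫_{[0,∞)} dσ(t)/(t - z)` with `b ≥ 0` and `∫ dσ/(1+t) < ∞`, i.e.
`f ∈ N_S`. [cite: KacKrein1974, Supplement I Theorem S1.5.1] -/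
theorem isNevanlinnaStieltjes_of_nevanlinna_representation
    (h : Literature.Analysis.Complex.nevanlinna_representation) {f : ℂ → ℂ}
    (hf : DifferentiableOn ℂ f offNonnegAxis) (him : ∀ z : ℂ, 0 < z.im → 0 ≤ (f z).im)
    (hreal : ∀ s : ℝ, 0 < s → (f (-(s : ℂ))).im = 0)
    (hpos : ∀ s : ℝ, 0 < s → 0 ≤ (f (-(s : ℂ))).re)
    (hconj : ∀ z ∈ offNonnegAxis, f (conj z) = conj (f z)) : IsNevanlinnaStieltjes f := by
  -- Nevanlinna data
  have hpick : Literature.Analysis.Complex.IsPickFunction f :=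
    ⟨hf.mono (fun z hz => Or.inl (ne_of_gt hz)), fun z hz => him z hz⟩
  obtain ⟨b, c, μ, hc, hμ, hrep⟩ := (h f).1 hpick
  have hrep' : ∀ z : ℂ, 0 < z.im → f z = (b : ℂ) + (c : ℂ) * z +
      (Real.pi : ℂ)⁻¹ * ∫ t : ℝ, (((t : ℂ) - z)⁻¹ - (t : ℂ) / (1 + (t : ℂ) ^ 2)) ∂μ :=
    fun z hz => hrep z hz
  -- continuity on the negative axis
  have hcont : ∀ s : ℝ, 0 < s → ContinuousAt f (-(s : ℂ)) := fun s hs =>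
    hf.continuousOn.continuousAt (isOpen_offNonnegAxis'.mem_nhds (Or.inr (by simpa using hs)))
  -- the measure lives on `[0, ∞)`
  have hlim : ∀ x : ℝ, x < 0 →
      Tendsto (fun y : ℝ => (f ((x : ℂ) + y * Complex.I)).im) (𝓝[>] 0) (𝓝 0) := by
    intro x hx
    have hcx : ContinuousAt f (x : ℂ) := by
      have h := hcont (-x) (by linarith)
      simpa using h
    have hg : Tendsto (fun y : ℝ => (x : ℂ) + y * Complex.I) (𝓝 0) (𝓝 (x : ℂ)) := by
      have h := ((Complex.continuous_ofReal.tendsto (0 : ℝ)).mul_const Complex.I).const_add (x : ℂ)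
      simpa using h
    have h1 := (Complex.continuous_im.tendsto _).comp (hcx.tendsto.comp hg)
    have h0 : (f (x : ℂ)).im = 0 := by
      have h := hreal (-x) (by linarith)
      simpa using h
    rw [Function.comp_def, h0] at h1
    exact h1.mono_left nhdsWithin_le_nhds
  have hμ0 : μ (Iio 0) = 0 := measure_Iio_eq_zero_of_nevanlinna_repr hμ hc hrep' hlim
  -- the constants
  have hc0 : c = 0 := c_eq_zero_of_nonneg hμ hμ0 hc hrep' hcont hpos
  have hJ := integrable_moment_of_nonneg hμ hμ0 hrep' hcont hpos hc0
  have hb' := stieltjes_const_nonneg hμ hμ0 hrep' hcont hpos hc0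
  set b' : ℝ := b - Real.pi⁻¹ * ∫ t, t / (1 + t ^ 2) ∂μ with hb'def
  set σ : Measure ℝ := (ENNReal.ofReal Real.pi⁻¹) • μ with hσ
  refine ⟨b', σ, hb', ?_, ?_, ?_⟩
  · -- `σ((-∞,0)) = 0`
    rw [hσ, Measure.smul_apply, hμ0, smul_zero]
  · -- `∫ dσ/(1+t) < ∞`
    rw [hσ, lintegral_smul_measure]
    refine ENNReal.mul_lt_top ENNReal.ofReal_lt_top ?_
    have hg := (hμ.add hJ)
    calc ∫⁻ t, ENNReal.ofReal (1 + t)⁻¹ ∂μ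
        ≤ ∫⁻ t, ENNReal.ofReal ((1 + t ^ 2)⁻¹ + t / (1 + t ^ 2)) ∂μ := by
          refine lintegral_mono_ae ?_
          filter_upwards [ae_nonneg_of_measure_Iio_eq_zero hμ0] with t ht
          exact ENNReal.ofReal_le_ofReal (inv_one_add_le ht)
      _ ≤ ∫⁻ t, ‖(1 + t ^ 2)⁻¹ + t / (1 + t ^ 2)‖ₑ ∂μ := lintegral_ofReal_le_lintegral_enorm _
      _ < ⊤ := hg.2
  · -- the formula on `ℂ ∖ [0, ∞)`
    -- upper half-plane
    have hup : ∀ z : ℂ, 0 < z.im → f z = (b' : ℂ) + ∫ t : ℝ, ((t : ℂ) - z)⁻¹ ∂σ := by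
      intro z hz
      refine apply_eq_const_add_integral hμ hμ0 hJ (Or.inl hz.ne') ?_
      rw [hrep' z hz, hc0]
      push_cast
      ring
    intro z hz
    rcases lt_trichotomy z.im 0 with hzi | hzi | hzi
    · -- lower half-plane, by conjugation symmetry
      have hw : 0 < (conj z).im := by simpa using hzi
      have h1 := hconj (conj z) (conj_mem_offNonnegAxis' hz)
      rw [Complex.conj_conj] at h1
      rw [h1, hup _ hw, map_add, Complex.conj_ofReal, ← integral_conj]
      congr 1
      refine integral_congr_ae (ae_of_all _ fun t => ?_)
      dsimp only
      rw [map_inv₀, map_sub, Complex.conj_ofReal, Complex.conj_conj]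
    · -- negative axis
      have hre : z.re < 0 := by
        rcases hz with h | h
        · exact absurd hzi h
        · exact h
      have hzs : z = -((-z.re : ℝ) : ℂ) := Complex.ext (by simp) (by simp [hzi])
      have hneg := nevanlinna_repr_neg hμ hμ0 hrep' hcont (s := -z.re) (by linarith)
      rw [← hzs] at hneg
      refine apply_eq_const_add_integral hμ hμ0 hJ hz ?_
      rw [hneg, hc0]
      push_cast
      ring
    · exact hup z hzi

end Stieltjes

end Literature.Analysis.InverseSpectral

end
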